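import Literature.MathematicalPhysics.QuantumFieldTheory.Balaban1983to89.B9Eq386GreenkLipschitzEnergyTwoBackgrounds
import Literature.MathematicalPhysics.QuantumFieldTheory.Balaban1983to89.B9Eq325RLipschitzSqrtTowerTwoBackgroundsLinear
import Literature.MathematicalPhysics.QuantumFieldTheory.Balaban1983to89.B9Thm311SmallFieldCoercivityTowerClosed

/-!
# `Balaban1983to89.B9Eq386GreenkLipschitzEnergyTwoBackgroundsLetterfree` — T. Bałaban, *Propagators for lattice gauge theories in a background field*, Commun.
# Math. Phys. **99** (1985) 389–434 [Balaban1985BackgroundPropagators] Thm 3.4 p. 400 with (3.84)–(3.86) p. 407 on print's diagonal, between two small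
# backgrounds: **INTENT-8's `‖G_k(U)y − G_k(V)y‖_{N₁} ≤ C·δ·‖y‖` WITH THE `C_R^{(2)}`∕`hR2` BINDERS REMOVED** — the displayed two-background `R`-letter of
# `B9Eq386GreenkLipschitzEnergyTwoBackgrounds` is DISCHARGED BY NAME by this lineage's packaged `B9Eq325RLipschitzSqrtTowerTwoBackgroundsLinear.
# exists_norm_RofUk_sub_RofUk_le_two_backgrounds` (`∃ α₀ C` closed in `(d, M_φ, M_φ′, L, r)`); `∃ α₀ δ₀ C` BEFORE EVERY BINDER, NO operator-letter hypothesis left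
# except the positivity witnesses

statement-level skeleton of published theorems with citation tags; proofs where landed; nothing here is a claim about the Yang–Mills mass gap

PDF held: `paper:balaban1985-cmp99-background-propagators` (journal page = PDF page + 388), pp. 395, 400, 407 through the suppliers' quotations.

CITATION HEADER (lean-in-tree rule 2026-08-18).  Audit cell `pub-balaban`, sub-cell `t4`, NE9 crux team (2): LEAF PROVER 04 (`b2b-balaban-t4-ne9-formalise-leaf-04`
gen 77), INTENT-9 — the pattern of ne9-leaf-02's `B9Eq3126H1kLipschitzEnergyLetterfree` (one background) applied to the (b3) Green storey.

WHAT IS PROVED (sorry-free; 0 `def`; [folklore] composition BY NAME of two landed `∃`-theorems + `min` of two ceilings; nothing of [B9] asserted as printed).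
* **`exists_norm_G1k_sub_G1k_le_two_backgrounds_letterfree`** — INTENT-8's statement verbatim MINUS the binder
  `(∀ s, ‖R_k(U)s − R_k(V)s‖ ≤ C_R^{(2)}δ‖s‖)`: `∃ α₀ δ₀ C > 0` (closed in `(d, a, L, M_φ, M_φ′, r, C_τ, ρ_w)`) such that under E162's per-level data for `U`, `V`
  (base `α′_j ≤ 1∕128`), common level smallness `ε_j ≤ αr^j`, level closeness `δ_j ≤ δr^j`, `hRS` ×2, unit bounds, the windows `αη` ∕ `αη²` (both), the
  closeness windows `δη` ∕ `δη²`, `0 ≤ α ≤ α₀`, `0 ≤ δ ≤ δ₀`, ANY positivity witnesses and every `y`: the three bounds `≤ C·δ·‖y‖`.  MECHANISM: the level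
  averages are `U1`-valued on bonds from E162's `hU1` (`hLb_of_hU1`), so the packaged `R`-letter's binders are all present; `α₀ = min(α_R, α_G)`.
MODEL ∕ DECLARED READINGS.  Those of INTENT-8; the Lipschitz continuity `U ↦ Ū` (the level profiles) stays DISPLAYED.
HONEST SCOPE.  FIRST order between two small backgrounds on the diagonal ONLY; no decay, no kernel bound.  NOT summit progress (cell pub-balaban: NE9 NOT
PRINTED ∕ NOT PROVED; «NE9 ⇐ the named binders»; row WALLED ON A MODEL (O-NE9-1; #5 UNRULED); spine PROVED 0∕9; rung (B)+1 finite T⁴ — NOT infinite volume,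
NOT mass gap, NOT BetaPertH, NOT Clay).  HONEST DEPENDENCY (cell line): continuum YM on T⁴ ⇐ BetaPertH ∧ nine spine estimates (0/9 proved); BetaPertH ⇐ (D1) ∧
(D4) ∧ CAP+tail; G-an2-4 gates asym, D1 and NE2/3/4.  NEW file; nothing modified.  Net new unproved facts: 0.
-/

noncomputable section

open scoped InnerProductSpace ComplexConjugate BigOperators

namespace Literature.MathematicalPhysics.QuantumFieldTheory.Balaban1983to89.B9Eq386GreenkLipschitzEnergyTwoBackgroundsLetterfree

open B4Sect5Torus (TSite)
open B9SectCLatticeCarrier (Bond)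
open B11Eq103H1Complex (SiteL2K BondL2K covDivL2K)
open B9Eq310HessianOperator (adTransportW covCurlL2K)
open B9Eq310DeltaPrime (plaqHolU)
open B9Eq315QTorus (perCfg cornerSite)
open B9Eq315QTower (towerP UlevOf)
open B9Eq326OperatorTower (laplaceAk QkW RofUk)
open B7Prop1Explicit (U1 Wcx boxVec)
open B9Thm311SmallFieldCoercivityTowerClosed (hLb_of_hU1)
open B9Eq325RLipschitzSqrtTowerTwoBackgroundsLinear (exists_norm_RofUk_sub_RofUk_le_two_backgrounds)
open B9Eq386GreenkLipschitzEnergyTwoBackgrounds (exists_norm_G1k_sub_G1k_le_two_backgrounds_closed)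

variable {d : ℕ} (L : ℕ) [NeZero L] (hL : 1 ≤ L)
  {𝔸 : Type*} [NormedRing 𝔸] [NormedAlgebra ℂ 𝔸] [CompleteSpace 𝔸] [NormOneClass 𝔸] [StarRing 𝔸] [NormedStarGroup 𝔸] [StarModule ℂ 𝔸]
  {W : Type*} [NormedAddCommGroup W] [InnerProductSpace ℂ W] [FiniteDimensional ℂ W] (φ : W ≃ₗ[ℂ] 𝔸)
  {Mφ Mφ' : ℝ} (hMφ : 0 ≤ Mφ) (hMφ' : 0 ≤ Mφ') (hφ : ∀ w, ‖φ w‖ ≤ Mφ * ‖w‖) (hφ' : ∀ X, ‖φ.symm X‖ ≤ Mφ' * ‖X‖)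
  {a : ℝ} (ha : 0 < a) {r : ℝ} (hr0 : 0 ≤ r) (hr1 : r < 1)
  (τ : 𝔸 →ₗ[ℂ] ℂ) {Cτ : ℝ} (hτ : ∀ X, ‖τ X‖ ≤ Cτ * ‖X‖) (hCτ : 0 ≤ Cτ) {ρw : ℝ} (hρw : 0 ≤ ρw)

include hMφ hMφ' hφ hφ' ha hr0 hr1 hτ hCτ hρw

/-- **(3.86) BETWEEN TWO SMALL BACKGROUNDS IN THE ENERGY NORM ON THE DIAGONAL, LETTER-FREE**: INTENT-8's `exists_norm_G1k_sub_G1k_le_two_backgrounds_closed` with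
its `R`-letter binder discharged by `exists_norm_RofUk_sub_RofUk_le_two_backgrounds` — `∃ α₀ δ₀ C > 0` before every binder, then for ANY positivity witnesses
and every `y`: `‖G_k(U)y − G_k(V)y‖, ‖curl₁(…)‖, ‖div₁(…)‖ ≤ C·δ·‖y‖`. [cite: Balaban1985BackgroundPropagators, Thm 3.4 p.400, (3.84)–(3.86) p.407, (3.25) p.395, (3.35) p.396] -/
theorem exists_norm_G1k_sub_G1k_le_two_backgrounds_letterfree :
    ∃ α₀ δ₀ C : ℝ, 0 < α₀ ∧ 0 < δ₀ ∧ 0 < C ∧ ∀ (n : ℕ) (η : ℝ), η * (L : ℝ) ^ (n + 1) = 1 →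
      ∀ (c₀ c₁ : ℝ) [Fact (0 < c₀)] [Fact (0 < c₁)], c₀ * ((L : ℝ) ^ (n + 1)) ^ d = c₁ → |η| ^ d / c₀ ≤ ρw →
      ∀ (m : Fin d → ℕ) [∀ i, NeZero (m i)] (U V : Bond d (towerP L m (n + 1)) → 𝔸ˣ) (αU : ℕ → ℝ) (hα1 : ∀ j, αU j ≤ 1 / 64)
        (hU1 : ∀ (j : ℕ) (x : B7Prop1Explicit.Site d) (κ : Fin d), perCfg (towerP L m (j + 1)) (UlevOf L m (n + 1) U j) x κ ∈ U1 𝔸)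
        (hreg : ∀ (j : ℕ) (y : TSite d (towerP L m j)) (κ : Fin d) (r : Fin d → Fin L),
          ‖((Wcx L (perCfg (towerP L m (j + 1)) (UlevOf L m (n + 1) U j)) (cornerSite L y) κ (boxVec L r) : 𝔸ˣ) : 𝔸) - 1‖ ≤ αU j)
        (αV : ℕ → ℝ) (hα1' : ∀ j, αV j ≤ 1 / 64)
        (hV1 : ∀ (j : ℕ) (x : B7Prop1Explicit.Site d) (κ : Fin d), perCfg (towerP L m (j + 1)) (UlevOf L m (n + 1) V j) x κ ∈ U1 𝔸)
        (hregV : ∀ (j : ℕ) (y : TSite d (towerP L m j)) (κ : Fin d) (r : Fin d → Fin L),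
          ‖((Wcx L (perCfg (towerP L m (j + 1)) (UlevOf L m (n + 1) V j)) (cornerSite L y) κ (boxVec L r) : 𝔸ˣ) : 𝔸) - 1‖ ≤ αV j),
        (∀ j, αV j ≤ 1 / 128) →
      ∀ (εU : ℕ → ℝ), (∀ j, 0 ≤ εU j) → (∀ (j : ℕ) (b : Bond d (towerP L m (j + 1))), ‖(UlevOf L m (n + 1) U j b : 𝔸) - 1‖ ≤ εU j) →
        (∀ (j : ℕ) (b : Bond d (towerP L m (j + 1))), ‖(UlevOf L m (n + 1) V j b : 𝔸) - 1‖ ≤ εU j) →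
      ∀ (δUV : ℕ → ℝ), (∀ j, 0 ≤ δUV j) →
        (∀ (j : ℕ) (b : Bond d (towerP L m (j + 1))), ‖(UlevOf L m (n + 1) U j b : 𝔸) - (UlevOf L m (n + 1) V j b : 𝔸)‖ ≤ δUV j) →
      ∀ {α δ : ℝ}, 0 ≤ α → α ≤ α₀ → 0 ≤ δ → δ ≤ δ₀ →
        (∀ (b : Bond d (towerP L m (n + 1))) (v u : W), ⟪adTransportW φ U b v, u⟫_ℂ = ⟪v, adTransportW φ (fun b => (U b)⁻¹) b u⟫_ℂ) →
        (∀ (b : Bond d (towerP L m (n + 1))) (v u : W), ⟪adTransportW φ V b v, u⟫_ℂ = ⟪v, adTransportW φ (fun b => (V b)⁻¹) b u⟫_ℂ) →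
        (∀ b, U b ∈ U1 𝔸) → (∀ b, V b ∈ U1 𝔸) → (∀ b, ‖(U b : 𝔸) - 1‖ ≤ α * η) → (∀ b, ‖(V b : 𝔸) - 1‖ ≤ α * η) →
        (∀ p : B9SectCLatticeCarrier.Plaq d (towerP L m (n + 1)), ‖(plaqHolU U p : 𝔸) - 1‖ ≤ α * η ^ 2) →
        (∀ p : B9SectCLatticeCarrier.Plaq d (towerP L m (n + 1)), ‖(plaqHolU V p : 𝔸) - 1‖ ≤ α * η ^ 2) →
        (∀ b, ‖(U b : 𝔸) - (V b : 𝔸)‖ ≤ δ * η) →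
        (∀ p : B9SectCLatticeCarrier.Plaq d (towerP L m (n + 1)), ‖(plaqHolU U p : 𝔸) - (plaqHolU V p : 𝔸)‖ ≤ δ * η ^ 2) →
        (∀ j < n + 1, εU j ≤ α * r ^ j) → (∀ j, δUV j ≤ δ * r ^ j) →
        ∀ (hposU : ∀ x : BondL2K ℂ d (towerP L m (n + 1)) c₀ W, x ≠ 0 →
            0 < RCLike.re ⟪x, laplaceAk L m n φ η U hL αU hα1 hU1 hreg τ (c₀ := c₀) (c₁ := c₁) a x⟫_ℂ)
          (hposV : ∀ x : BondL2K ℂ d (towerP L m (n + 1)) c₀ W, x ≠ 0 →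
            0 < RCLike.re ⟪x, laplaceAk L m n φ η V hL αV hα1' hV1 hregV τ (c₀ := c₀) (c₁ := c₁) a x⟫_ℂ)
          (y : BondL2K ℂ d (towerP L m (n + 1)) c₀ W),
          ‖B11Eq103H1Complex.greenK (laplaceAk L m n φ η U hL αU hα1 hU1 hreg τ (c₀ := c₀) (c₁ := c₁) a) hposU y -
            B11Eq103H1Complex.greenK (laplaceAk L m n φ η V hL αV hα1' hV1 hregV τ (c₀ := c₀) (c₁ := c₁) a) hposV y‖ ≤ C * δ * ‖y‖ ∧
          ‖covCurlL2K ℂ c₀ ((η : ℂ))⁻¹ (adTransportW φ (fun _ : Bond d (towerP L m (n + 1)) => (1 : 𝔸ˣ)))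
            (B11Eq103H1Complex.greenK (laplaceAk L m n φ η U hL αU hα1 hU1 hreg τ (c₀ := c₀) (c₁ := c₁) a) hposU y -
            B11Eq103H1Complex.greenK (laplaceAk L m n φ η V hL αV hα1' hV1 hregV τ (c₀ := c₀) (c₁ := c₁) a) hposV y)‖ ≤ C * δ * ‖y‖ ∧
          ‖covDivL2K ℂ c₀ ((η : ℂ))⁻¹ (adTransportW φ fun _ : Bond d (towerP L m (n + 1)) => (1 : 𝔸ˣ)⁻¹)
            (B11Eq103H1Complex.greenK (laplaceAk L m n φ η U hL αU hα1 hU1 hreg τ (c₀ := c₀) (c₁ := c₁) a) hposU y -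
            B11Eq103H1Complex.greenK (laplaceAk L m n φ η V hL αV hα1' hV1 hregV τ (c₀ := c₀) (c₁ := c₁) a) hposV y)‖ ≤ C * δ * ‖y‖ := by
  obtain ⟨αR, CR, hαR, hCR, HR⟩ := exists_norm_RofUk_sub_RofUk_le_two_backgrounds (d := d) L φ hMφ hMφ' hφ hφ' hr0 hr1
  obtain ⟨α₁, δ₀, C, hα₁, hδ₀, hC, H⟩ :=
    exists_norm_G1k_sub_G1k_le_two_backgrounds_closed L hL φ hMφ hMφ' hφ hφ' ha hr0 hr1 τ hτ hCτ hρw hCR.le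
  refine ⟨min αR α₁, δ₀, C, lt_min hαR hα₁, hδ₀, hC, ?_⟩
  intro n η hηL c₀ c₁ _ _ hw hρ m _ U V αU hα1 hU1 hreg αV hα1' hV1 hregV hα128 εU hεU hUε hVε δUV hδUV hLUV α δ hα0 hαle hδ0 hδle
    hRSU hRSV hUb hVb hUη hVη hplU hplV hUV hpp hεg hδg hposU hposV y
  have hαR' : α ≤ αR := hαle.trans (min_le_left _ _)
  have hα₁' : α ≤ α₁ := hαle.trans (min_le_right _ _)
  have hLbU := hLb_of_hU1 L m n U hU1
  have hLbV := hLb_of_hU1 L m n V hV1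
  have hR2 : ∀ s : SiteL2K ℂ d (towerP L m (n + 1)) c₀ W, ‖RofUk L m n φ η U s - RofUk L m n φ η V s‖ ≤ CR * δ * ‖s‖ :=
    HR n η hηL c₀ c₁ hw m U V εU δUV hεU hδUV hUε hVε hLbU hLbV hLUV hα0 hαR' hδ0 hRSU hRSV hUb hVb hUη hVη hUV hεg (fun j _ => hδg j)
  exact H n η hηL c₀ c₁ hw hρ m U V αU hα1 hU1 hreg αV hα1' hV1 hregV hα128 εU hεU hUε hVε δUV hδUV hLUV hα0 hα₁' hδ0 hδle hRSU hRSV hUb hVb hUη hVη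
    hplU hplV hUV hpp hεg hδg hR2 hposU hposV y

end Literature.MathematicalPhysics.QuantumFieldTheory.Balaban1983to89.B9Eq386GreenkLipschitzEnergyTwoBackgroundsLetterfree

end
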